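import Summits.AnomalousDissipation.AnomalousDissipation.Theorems.FloorCertificate.Negative.WeakDuality

/-!
# Stub `stub_ceilingOfTaxed` (T3) of the line `Sketch`
# (crux stmt-AnomalousDissipation-14086, `TaylorCertificates.FloorCertificateEnsembleCeiling`)

THE ENSEMBLE CEILING FROM A TAXED FLOOR, AT ONE VISCOSITY. If the energy-taxed floor with constants
`(ε₁, κ)`, `ε₁ ≥ 0`, `κ > 0`, and multiplier `(Ψ, α)`, `α ≤ 0`,
`ε₁ + κ|u|² ≤ ν‖∇u‖² + ⟨F(u), Ψ'(u)⟩ + 2α((u,f) − ν‖∇u‖²)`,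
holds at every finite-enstrophy state `u` of the Leray ball `|u|² ≤ 16‖f‖²/ν²` of `(f, ν)`
(`ν > 0`, `f ∈ L²`), then every stationary statistical solution `μ` of `NS_ν(f)` (FMRT IV Def. 1.3)
with integrable energy has mean energy `e(μ) ≤ (‖f‖₂/κ)²`.

Proof. Weak duality with the budget `g(u) = ε₁ + κ|u|²` (the landed `stub_weakDualityBudget`, inlined below as
`weakDualityBudget_local`, fed the
tree facts `prob`, `ae_norm_le` + `ball_of_norm_le`, `enstrophy_finite`, `generator`,
`integrable_pairing`, `energy_le_holds` of a stationary statistical solution) gives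
`ε₁ + κ e(μ) ≤ ε(μ)`; the injection bound `ε(μ) ≤ ‖f‖₂ √e(μ)`
(`Torus.ensembleDissipation_le_of_isStationary_holds`) and `ε₁ ≥ 0` give `κ a² ≤ ‖f‖₂ a` with
`a = √e(μ)`, whence `a ≤ ‖f‖₂/κ` and `e(μ) = a² ≤ (‖f‖₂/κ)²`.

References: Foias–Manley–Rosa–Temam 2001, Ch. IV Def. 1.3, (1.29)–(1.34) and Ch. V §1 (stationary
statistical solutions, mean energy and dissipation); Doering–Foias 2002, §2 (`ε ≤ ‖f‖ U`).
-/

set_option linter.dupNamespace false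

noncomputable section

namespace Summit.AnomalousDissipation.AnomalousDissipation.Theorems.TaylorCertificatesFloorCertificateEnsembleCeiling

open MeasureTheory
open scoped ENNReal
open Literature.Analysis.FunctionSpaces Literature.Analysis.FluidPDE
open Summit.AnomalousDissipation.AnomalousDissipation.Theorems.FloorCertificate.Negative

/-- Local notation: real vector fields on `T³`. -/
local notation "Vec3" => (UnitAddTorus (Fin 3)) → (EuclideanSpace ℝ (Fin 3))
/-- Local notation: `L²(T³; ℝ³)`. -/
local notation "L2" => (Lp (EuclideanSpace ℝ (Fin 3)) 2 (volume : Measure (UnitAddTorus (Fin 3))))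
/-- Local notation: the energy space `H`. -/
local notation "H3" => (Torus.energySpace (Fin 3))

/-- Weak duality with a state-dependent budget over the relaxed class — a file-local verbatim copy of the
LANDED `stub_weakDualityBudget` (`Theorems/TaylorCertificatesFloorCertificateEnsembleCeilingStubWeakDualityBudget.lean`,
p89283), inlined here only because that module has no olean on the hub yet (farm build backlog); `private`,
so no duplicate name enters the tree. -/
-- adapted from Theorems/TaylorCertificatesFloorCertificateEnsembleCeilingStubWeakDualityBudget.lean (verbatim)
private theorem weakDualityBudget_local :
    ∀ (ν : ℝ) (f : Vec3) (Φ₁ : Torus.CylindricalTest (Fin 3)) (θ₁ : ℝ) (g : H3 → ℝ) (μ : Measure H3),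
      θ₁ ≤ 0 →
      (∀ u : H3, Torus.eGradNormSq ((u : L2) : Vec3) ≠ ⊤ → ‖u‖ ^ 2 ≤ 16 * (∫ x, ‖f x‖ ^ 2) / ν ^ 2 →
        g u ≤ ν * (Torus.eGradNormSq ((u : L2) : Vec3)).toReal + Torus.nsGeneratorPairing ν f u (Φ₁.grad u) +
          2 * θ₁ * (Torus.pairing (u : L2) f - ν * (Torus.eGradNormSq ((u : L2) : Vec3)).toReal)) →
      IsProbabilityMeasure μ →
      (∀ᵐ u ∂μ, ‖u‖ ^ 2 ≤ 16 * (∫ x, ‖f x‖ ^ 2) / ν ^ 2) →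
      Torus.ensembleEnstrophy μ < ⊤ →
      Integrable (fun u : H3 => Torus.nsGeneratorPairing ν f u (Φ₁.grad u)) μ →
      ∫ u, Torus.nsGeneratorPairing ν f u (Φ₁.grad u) ∂μ = 0 →
      Integrable (fun u : H3 => Torus.pairing (u : L2) f) μ →
      Torus.ensembleDissipation ν μ ≤ ∫ u, Torus.pairing (u : L2) f ∂μ →
      Integrable g μ →
      ∫ u, g u ∂μ ≤ Torus.ensembleDissipation ν μ := by
  intro ν f Φ₁ θ₁ g μ hθ₁ hfloor _hprob hball hZ hC hC0 hB hE hg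
  set G : H3 → ℝ≥0∞ := fun u => Torus.eGradNormSq ((u : L2) : Vec3)
  have hGm : Measurable G := Torus.measurable_eGradNormSq_coe
  have hGfin : ∫⁻ u, G u ∂μ < ∞ := hZ
  have hGlt : ∀ᵐ u ∂μ, G u < ∞ := ae_lt_top hGm hGfin.ne
  have hA : Integrable (fun u => (G u).toReal) μ :=
    integrable_toReal_of_lintegral_ne_top hGm.aemeasurable hGfin.ne
  -- the budget FLOOR holds `μ`-a.e.
  have hae : ∀ᵐ u ∂μ, g u ≤ ν * (G u).toReal + Torus.nsGeneratorPairing ν f u (Φ₁.grad u) +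
      2 * θ₁ * (Torus.pairing (u : L2) f - ν * (G u).toReal) := by
    filter_upwards [hGlt, hball] with u hu hb
    exact hfloor u hu.ne hb
  -- integrate
  have h1 : Integrable (fun u : H3 => ν * (G u).toReal) μ := hA.const_mul ν
  have h2 : Integrable
      (fun u : H3 => ν * (G u).toReal + Torus.nsGeneratorPairing ν f u (Φ₁.grad u)) μ :=
    h1.add hC
  have h3 : Integrable (fun u : H3 => Torus.pairing (u : L2) f - ν * (G u).toReal) μ := hB.sub h1
  have h4 : Integrable
      (fun u : H3 => 2 * θ₁ * (Torus.pairing (u : L2) f - ν * (G u).toReal)) μ :=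
    h3.const_mul _
  have hint : Integrable (fun u : H3 => ν * (G u).toReal + Torus.nsGeneratorPairing ν f u (Φ₁.grad u) +
      2 * θ₁ * (Torus.pairing (u : L2) f - ν * (G u).toReal)) μ := h2.add h4
  have hmono := integral_mono_ae hg hint hae
  have hsplit : ∫ u : H3, (ν * (G u).toReal + Torus.nsGeneratorPairing ν f u (Φ₁.grad u) +
      2 * θ₁ * (Torus.pairing (u : L2) f - ν * (G u).toReal)) ∂μ =
      ν * (∫⁻ u, G u ∂μ).toReal + 0 +
        2 * θ₁ * (∫ u : H3, Torus.pairing (u : L2) f ∂μ - ν * (∫⁻ u, G u ∂μ).toReal) := by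
    rw [integral_add h2 h4, integral_add h1 hC, integral_const_mul, integral_const_mul,
      integral_sub hB h1, integral_const_mul, hC0, integral_toReal hGm.aemeasurable hGlt]
  rw [hsplit] at hmono
  -- the global energy inequality `ν ∫‖∇u‖² ≤ ∫ (u,f)`
  have hE' : ν * (∫⁻ u, G u ∂μ).toReal ≤ ∫ u, Torus.pairing (u : L2) f ∂μ := hE
  have hθ : 2 * θ₁ * (∫ u, Torus.pairing (u : L2) f ∂μ - ν * (∫⁻ u, G u ∂μ).toReal) ≤ 0 :=
    mul_nonpos_of_nonpos_of_nonneg (by linarith) (by linarith)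
  change ∫ u, g u ∂μ ≤ ν * (∫⁻ u, G u ∂μ).toReal
  linarith


/-- The friction algebra: `κ a² ≤ e ≤ F a`, `a ≥ 0`, `F ≥ 0`, `κ > 0` force `a² ≤ (F/κ)²`. -/
private theorem sq_le_of_friction_aux {κ a F e : ℝ} (hκ : 0 < κ) (ha : 0 ≤ a) (hF : 0 ≤ F)
    (h1 : κ * a ^ 2 ≤ e) (h2 : e ≤ F * a) : a ^ 2 ≤ (F / κ) ^ 2 := by
  have h3 : κ * a ^ 2 ≤ F * a := le_trans h1 h2
  have h4 : a ≤ F / κ := by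
    rw [le_div_iff₀ hκ]
    rcases eq_or_lt_of_le ha with h0 | hpos
    · rw [← h0]; simp; positivity
    · nlinarith
  exact pow_le_pow_left₀ ha h4 2

/-- **T3 `stub_ceilingOfTaxed`** — THE ENSEMBLE CEILING FROM A TAXED FLOOR at one viscosity. If the
taxed floor `ε₁ + κ|u|² ≤ ν‖∇u‖² + ⟨F(u),Ψ'(u)⟩ + 2α((u,f) − ν‖∇u‖²)` (`ε₁ ≥ 0`, `κ > 0`, `α ≤ 0`)
holds at every finite-enstrophy state of the Leray ball of `(f, ν)` (`ν > 0`, `f ∈ L²`), then every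
stationary statistical solution `μ` of `NS_ν(f)` with integrable energy has `e(μ) ≤ (‖f‖₂/κ)²`:
weak duality with the budget `g = ε₁ + κ|u|²` (`weakDualityBudget_local` fed `prob`,
`ae_norm_le` + `ball_of_norm_le`, `enstrophy_finite`, `generator`, `integrable_pairing`,
`energy_le_holds`) gives `ε₁ + κ e(μ) ≤ ε(μ)`, the injection bound
`Torus.ensembleDissipation_le_of_isStationary_holds` gives `ε(μ) ≤ ‖f‖₂ √e(μ)`, and
`κ a² ≤ ‖f‖₂ a` with `a = √e(μ)` forces `a² ≤ (‖f‖₂/κ)²`. -/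
theorem stub_ceilingOfTaxed :
    ∀ (ν : ℝ) (f : Vec3) (Ψ : Torus.CylindricalTest (Fin 3)) (α ε₁ κ : ℝ) (μ : Measure H3),
      0 < ν → MemLp f 2 volume → 0 ≤ ε₁ → 0 < κ → α ≤ 0 →
      (∀ u : H3, Torus.eGradNormSq ((u : L2) : Vec3) ≠ ⊤ → ‖u‖ ^ 2 ≤ 16 * (∫ x, ‖f x‖ ^ 2) / ν ^ 2 →
        ε₁ + κ * ‖u‖ ^ 2 ≤ ν * (Torus.eGradNormSq ((u : L2) : Vec3)).toReal +
          Torus.nsGeneratorPairing ν f u (Ψ.grad u) +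
          2 * α * (Torus.pairing (u : L2) f - ν * (Torus.eGradNormSq ((u : L2) : Vec3)).toReal)) →
      Torus.IsStationaryStatisticalSolution ν f μ → Integrable (fun v : H3 => ‖v‖ ^ 2) μ →
      Torus.ensembleEnergy μ ≤ (Real.sqrt (∫ x, ‖f x‖ ^ 2) / κ) ^ 2 := by
  intro ν f Ψ α ε₁ κ μ hν hf hε₁ hκ hα hfloor hμ hint
  haveI := hμ.prob
  -- weak duality with the budget `g = ε₁ + κ|u|²`
  have hg : Integrable (fun v : H3 => ε₁ + κ * ‖v‖ ^ 2) μ :=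
    (integrable_const ε₁).add (hint.const_mul κ)
  have hball : ∀ᵐ u ∂μ, ‖u‖ ^ 2 ≤ 16 * (∫ x, ‖f x‖ ^ 2) / ν ^ 2 := by
    filter_upwards [hμ.ae_norm_le hν hf] with u hu
    exact ball_of_norm_le hν hf hu
  have hA : ∫ u, (fun v : H3 => ε₁ + κ * ‖v‖ ^ 2) u ∂μ ≤ Torus.ensembleDissipation ν μ :=
    weakDualityBudget_local ν f Ψ α (fun v : H3 => ε₁ + κ * ‖v‖ ^ 2) μ hα hfloor hμ.prob hball
      hμ.enstrophy_finite (hμ.generator Ψ).1 (hμ.generator Ψ).2 (hμ.integrable_pairing hf)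
      (Torus.IsStationaryStatisticalSolution.energy_le_holds hμ hf) hg
  have hsplit : ∫ u, (fun v : H3 => ε₁ + κ * ‖v‖ ^ 2) u ∂μ = ε₁ + κ * Torus.ensembleEnergy μ := by
    show ∫ u : H3, (ε₁ + κ * ‖u‖ ^ 2) ∂μ = ε₁ + κ * Torus.ensembleEnergy μ
    rw [integral_add (integrable_const ε₁) (hint.const_mul κ), integral_const_mul]
    simp [Torus.ensembleEnergy]
  rw [hsplit] at hA
  -- the injection bound `ε(μ) ≤ ‖f‖₂ √e(μ)` and the friction algebra
  have hI := Torus.ensembleDissipation_le_of_isStationary_holds hμ hf hint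
  have hEnn : 0 ≤ Torus.ensembleEnergy μ := integral_nonneg fun v => by positivity
  set a : ℝ := Real.sqrt (Torus.ensembleEnergy μ) with ha_def
  have ha : 0 ≤ a := Real.sqrt_nonneg _
  have ha2 : a ^ 2 = Torus.ensembleEnergy μ := Real.sq_sqrt hEnn
  have h1 : κ * a ^ 2 ≤ Torus.ensembleDissipation ν μ := by rw [ha2]; linarith
  have := sq_le_of_friction_aux hκ ha (Real.sqrt_nonneg _) h1 hI
  rwa [ha2] at this

end Summit.AnomalousDissipation.AnomalousDissipation.Theorems.TaylorCertificatesFloorCertificateEnsembleCeiling
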